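import Mathlib.Tactic.DeriveFintype
import Literature.Computability.Complexity.OracleComposition
import Literature.Computability.Complexity.CoinTruncation
import Literature.Computability.Complexity.LengthCompare
import Literature.Computability.Complexity.PRelHierarchy
import Literature.Computability.Complexity.BranchingFn
import HarnessLib

/-!
# The composite oracle machine is polynomial-time (discharge of `OracleAlg.isPolyTime_compose`)

Trunk `CplxCore`, machine-level companion of `OracleComposition.lean`, which reduces the
closure of relativised polynomial time under composition — `f ∈ FP^O ⟹ P^f ⊆ P^O`,
`FP^f ⊆ FP^O`, hence `P^{P^O} = P^O` and transitivity of `≤ᵀₚ` (Ladner–Lynch–Selman 1975,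
§2; Arora–Barak 2009, §3.4 with Claim 1.6) — to ONE machine fact: the step function of the
composite machine `OracleComposition.compose M N eb prm` (a clocked iteration of the typed
micro-step `G = GN ∘ GM` on a state) is polynomial-time in the transcript model of `Oracle.lean`
for suitable resource parameters. This file proves that fact,

* `Literature.CplxCore.OracleAlg.isPolyTime_compose_holds : OracleAlg.isPolyTime_compose`,

and draws the unconditional conclusions

* `OracleAlg.PRel_subset_PRel_of_mem_FPRel` (`f ∈ FP^O ⟹ P^f ⊆ P^O`),
  `OracleAlg.FPRel_subset_FPRel_of_mem_FPRel` (`FP^f ⊆ FP^O`),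
  the function-oracle closure theorems (the language-oracle special cases
  `mem_PRel_of_polyTimeTuringReducible_holds`, `polyTimeTuringReducible_trans_holds` and
  `PRel_empty_holds` were discharged concurrently and independently in
  `CookReducibilityTransitive.lean` / `OracleEmpty.lean`; the conditional forms
  `OracleAlg.mem_PRel_of_polyTimeTuringReducible_of` etc. of `OracleComposition.lean` are now
  fed by `isPolyTime_compose_holds` as well).

No Turing machine is programmed. As in `OracleClosure.lean`, `CoinTruncation.lean`,
`StringCopy.lean`, the step function is assembled from the tree's `FinTM2` toolkit by
composition (`PolyTimeComputable.comp_holds`) and transport (`PolyTimeComputable.of_encode`):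

1. **Tape code** `enc s` of a state: the right-nested tuple
   `⟨phase, ⟨⟨1^bnd, 1^fuel⟩, ⟨⟨x, listBool fAns⟩, ⟨⟨u, listBool nAns⟩, ⟨blocks rest, ⟨out, res⟩⟩⟩⟩⟩⟩`
   (`boolPair` framing; one unit of fuel is `chunk bnd = 2·bnd + 4` symbols). An active
   half-step pays one unit for at most that many new symbols, so the micro-step never lengthens
   the tape (`length_enc_G_le`) and `PolyTimeComputable.iterate_of_le_add` (`TM2Iterate.lean`)
   clocks it (`polyTime_iterate_G`).
2. **Each half-step** is (pair combinators, `PrePost.toField`) ▸ (`PolyTimeComputable.firstField`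
   of the black-box step machine, the whole state kept as context; `TM2Context.lean`) ▸
   (`PrePost.fromField`, then a *bookkeeping string function* `postMF`/`postNF ∈ FP` with
   `postMF ⟨code r, enc s⟩ = enc (stepM eb s r)` (`postMF_spec`, `postNF_spec`)). The
   bookkeeping functions are *wirings* — `pairFn p q z = ⟨p z, q z⟩` and the projections
   `fstP`/`sndP` (`PRelHierarchy.lean`), the branching `iteFn` and constants `const_mem_FP`
   (`BranchingFn.lean`), the clamp `truncSndFn X` and the fuel decrement `dropSndFn (2X+4)`
   (`CoinTruncation.lean`), the length test `lenLeFn X` (`LengthCompare.lean`) — combined with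
   three finite-state transducers proved here (`Transducers.lean`): the *probe* `probeT tbl`
   (first symbols of five fields ↦ a table value: all finite decisions), `appendT` (one more
   answer in the transcript of `M`), `moveBlkT` (the next unconsumed answer into the transcript
   of `N`).
3. **Layout and readout**: the unary clocks `evalHdrFn`/`initFn` and `copyFn` produce three
   headers `hdr` carrying the clamp bound, the fuel and the iteration count
   (`preInit`, `preInit_apply`); the transducer `initT` lays out the iteration input
   (`initT_eval`, `polyTime_init`); `readoutT` extracts the result (`readoutT_eval`).

refactor: `OCM.listBool_encode_append_singleton` (here, `dup` form) and
`EmptySim.listBool_encode_append_singleton` (`OracleEmpty.lean`, landed concurrently) are twins;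
a librarian may keep one.

## References

* R. E. Ladner, N. A. Lynch, A. L. Selman, *A comparison of polynomial time reducibilities*,
  Theoret. Comput. Sci. 1 (1975), §2 (Prop. 2.1).
* S. Arora, B. Barak, *Computational Complexity: A Modern Approach*, CUP 2009, §3.4 (oracle
  machines), §1.3 and Claim 1.6, proof of Thm. 2.8 (polynomial-time machines compose), §1.4.1
  (clocked simulation), §0.1 (pairing).
* J. E. Hopcroft, J. D. Ullman, *Introduction to Automata Theory, Languages, and Computation*,
  1979, §2.7 (Mealy machines).
-/

namespace Literature.Computability.Complexity

open _root_.Computability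

namespace OCM

/-! ### Fields of right-nested tuples (`pairFn`, `fstP`, `sndP` are in `PRelHierarchy.lean`) -/

/-- Iterated second projection: the tail after `k` fields of a right-nested tuple. [folklore] -/
def sndIter : ℕ → List Bool → List Bool
  | 0 => id
  | k + 1 => sndIter k ∘ sndP

/-- Unfolding on a pair code (definitional). [folklore] -/
@[simp] theorem sndIter_zero (z : List Bool) : sndIter 0 z = z := rfl
/-- Unfolding on a pair code (definitional). [folklore] -/
@[simp] theorem sndIter_succ_boolPair (k : ℕ) (a b : List Bool) : sndIter (k + 1) (boolPair a b) = sndIter k b := by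
  simp [sndIter]

/-- `sndIter` is in `FP`. [folklore] -/
theorem sndIter_mem_FP : ∀ k, sndIter k ∈ FP
  | 0 => PolyTimeComputable.id _
  | k + 1 => comp_mem_FP (sndIter_mem_FP k) sndP_mem_FP

/-- The `k`-th field of a right-nested tuple `⟨f₀, ⟨f₁, … ⟩⟩`. [folklore] -/
def fld (k : ℕ) : List Bool → List Bool := fstP ∘ sndIter k

/-- `fld` is in `FP`. [folklore] -/
theorem fld_mem_FP (k : ℕ) : fld k ∈ FP := comp_mem_FP fstP_mem_FP (sndIter_mem_FP k)

/-- Unfolding on a pair code (definitional). [folklore] -/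
@[simp] theorem fld_zero_boolPair (a b : List Bool) : fld 0 (boolPair a b) = a := by simp [fld]
/-- Unfolding on a pair code (definitional). [folklore] -/
@[simp] theorem fld_succ_boolPair (k : ℕ) (a b : List Bool) : fld (k + 1) (boolPair a b) = fld k b := by
  simp [fld, sndIter]

/-! ### Probing the first symbols of the leading fields -/

open StrCopy (dup boolPair_eq_dup)

/-- States of the probe: index of the current field (`5` = done), a pending first symbol of a
doubled pair, and the first symbols recorded so far of fields `0 … 4`. [folklore] -/
abbrev Prb : Type := Fin 6 × Option Bool × (Fin 5 → Option Bool)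

/-- Transition of the probe: pairs `cc` are symbols of the current field (the first one is
recorded), an unequal pair is a field separator; after five fields the input is ignored.
Nothing is emitted. [folklore] -/
def prbStep (s : Prb) (c : Bool) : Prb × List Bool :=
  if h : 5 ≤ s.1.val then (s, []) else
    match s.2.1 with
    | none => ((s.1, some c, s.2.2), [])
    | some t =>
      if t = c then
        ((s.1, none, if s.2.2 ⟨s.1.val, by omega⟩ = none then
            Function.update s.2.2 ⟨s.1.val, by omega⟩ (some t) else s.2.2), [])
      else ((⟨s.1.val + 1, by omega⟩, none, s.2.2), [])

/-- **The probe transducer** with output table `tbl`: it reads `⟨F₀, ⟨F₁, ⟨F₂, ⟨F₃, ⟨F₄, T⟩⟩⟩⟩⟩`,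
records the first symbol of each of `F₀, …, F₄` and outputs `tbl` of the record
(`probeT_eval`). The finite decisions of the composite machine's bookkeeping are of this form.
[Arora–Barak 2009, §1.3 (finite control)] [folklore] -/
def probeT (tbl : Option Bool → Option Bool → Option Bool → Option Bool → Option Bool → List Bool) :
    FST Prb Bool Bool where
  init := (⟨0, by omega⟩, none, fun _ => none)
  step := prbStep
  front := fun s => tbl (s.2.2 0) (s.2.2 1) (s.2.2 2) (s.2.2 3) (s.2.2 4)
  keep := fun _ => false

variable (tbl : Option Bool → Option Bool → Option Bool → Option Bool → Option Bool → List Bool)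

/-- The transition function (definitional). [folklore] -/
@[simp] theorem probeT_step (s : Prb) (c : Bool) : (probeT tbl).step s c = prbStep s c := rfl

/-- The probe's output is the table value at the final record. [folklore] -/
theorem probeT_eval_eq (l : List Bool) :
    (probeT tbl).eval l =
      tbl (((probeT tbl).run (⟨0, by omega⟩, none, fun _ => none) l).1.2.2 0)
        (((probeT tbl).run (⟨0, by omega⟩, none, fun _ => none) l).1.2.2 1)
        (((probeT tbl).run (⟨0, by omega⟩, none, fun _ => none) l).1.2.2 2)
        (((probeT tbl).run (⟨0, by omega⟩, none, fun _ => none) l).1.2.2 3)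
        (((probeT tbl).run (⟨0, by omega⟩, none, fun _ => none) l).1.2.2 4) := by
  simp [FST.eval, probeT]

/-- In a field whose first symbol is already recorded, further doubled symbols change nothing.
[folklore] -/
theorem probeT_run_dup_of_isSome (i : ℕ) (hi : i < 5) (r : Fin 5 → Option Bool)
    (hr : r ⟨i, hi⟩ ≠ none) (F rest : List Bool) :
    ((probeT tbl).run (⟨i, by omega⟩, none, r) (dup F ++ rest)).1 =
      ((probeT tbl).run (⟨i, by omega⟩, none, r) rest).1 := by
  induction F with
  | nil => rfl
  | cons c F ih =>
    simp only [dup, List.flatMap_cons, List.cons_append, List.nil_append] at ih ⊢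
    rw [FST.run_cons, probeT_step, show prbStep (⟨i, by omega⟩, none, r) c =
      ((⟨i, by omega⟩, some c, r), []) by simp [prbStep, show ¬ (5 ≤ i) by omega]]
    simp only
    rw [FST.run_cons, probeT_step, show prbStep (⟨i, by omega⟩, some c, r) c =
      ((⟨i, by omega⟩, none, r), []) by simp [prbStep, show ¬ (5 ≤ i) by omega, hr]]
    simpa [dup] using ih

/-- **Reading one field**: from field position `i < 5` with nothing recorded there, the doubled
field `F` followed by the separator `01` records `F.head?` and moves to position `i + 1`.
[folklore] -/
theorem probeT_run_field (i : ℕ) (hi : i < 5) (r : Fin 5 → Option Bool)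
    (hr : r ⟨i, hi⟩ = none) (F rest : List Bool) :
    ((probeT tbl).run (⟨i, by omega⟩, none, r) (boolPair F rest)).1 =
      ((probeT tbl).run (⟨i + 1, by omega⟩, none, Function.update r ⟨i, hi⟩ F.head?) rest).1 := by
  rw [boolPair_eq_dup]
  have hsep : ∀ r' : Fin 5 → Option Bool,
      ((probeT tbl).run (⟨i, by omega⟩, none, r') (false :: true :: rest)).1 =
        ((probeT tbl).run (⟨i + 1, by omega⟩, none, r') rest).1 := by
    intro r'
    rw [FST.run_cons, probeT_step, show prbStep (⟨i, by omega⟩, none, r') false =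
      ((⟨i, by omega⟩, some false, r'), []) by simp [prbStep, show ¬ (5 ≤ i) by omega]]
    simp only
    rw [FST.run_cons, probeT_step, show prbStep (⟨i, by omega⟩, some false, r') true =
      ((⟨i + 1, by omega⟩, none, r'), []) by simp [prbStep, show ¬ (5 ≤ i) by omega]]
  cases F with
  | nil =>
    simp only [dup, List.flatMap_nil, List.nil_append, List.head?_nil]
    rw [hsep, Function.update_eq_self_iff.2 hr.symm]
  | cons c F =>
    simp only [dup, List.flatMap_cons, List.cons_append, List.nil_append, List.head?_cons]
    rw [FST.run_cons, probeT_step, show prbStep (⟨i, by omega⟩, none, r) c =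
      ((⟨i, by omega⟩, some c, r), []) by simp [prbStep, show ¬ (5 ≤ i) by omega]]
    simp only
    rw [FST.run_cons, probeT_step, show prbStep (⟨i, by omega⟩, some c, r) c =
      ((⟨i, by omega⟩, none, Function.update r ⟨i, hi⟩ (some c)), []) by
        simp [prbStep, show ¬ (5 ≤ i) by omega, hr]]
    simp only
    have := probeT_run_dup_of_isSome tbl i hi (Function.update r ⟨i, hi⟩ (some c))
      (by simp) F (false :: true :: rest)
    simp only [dup] at this
    rw [this, hsep]

/-- **The probe on five leading fields** records their first symbols. [folklore] -/
theorem probeT_eval (F₀ F₁ F₂ F₃ F₄ T : List Bool) :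
    (probeT tbl).eval (boolPair F₀ (boolPair F₁ (boolPair F₂ (boolPair F₃ (boolPair F₄ T))))) =
      tbl F₀.head? F₁.head? F₂.head? F₃.head? F₄.head? := by
  rw [probeT_eval_eq, probeT_run_field tbl 0 (by omega) _ rfl,
    probeT_run_field tbl 1 (by omega) _ (by simp), probeT_run_field tbl 2 (by omega) _ (by simp),
    probeT_run_field tbl 3 (by omega) _ (by simp), probeT_run_field tbl 4 (by omega) _ (by simp)]
  have hdone : ∀ (r : Fin 5 → Option Bool) (l : List Bool),
      ((probeT tbl).run (⟨5, by omega⟩, none, r) l).1 = (⟨5, by omega⟩, none, r) := by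
    intro r l
    induction l with
    | nil => rfl
    | cons c l ih =>
      rw [FST.run_cons, probeT_step, show prbStep (⟨5, by omega⟩, none, r) c =
        ((⟨5, by omega⟩, none, r), []) by simp [prbStep]]
      exact ih
  rw [hdone]
  simp [Function.update]

/-! ### Appending an answer to the transcript of `M`: `⟨⟨x, L⟩, ⟨Y, []⟩⟩ ↦ ⟨x, 11 L Y Y 01⟩` -/

/-- States of `appendT`: `a p₁ p₂` — inside the doubled first component of the first field
(two pending symbols, one per pairing level); `b p₁` — copying the rest of the first field;
`c p₁` — doubling the second field; `d` — done. [folklore] -/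
inductive App
  | a (p₁ p₂ : Option Bool)
  | b (p₁ : Option Bool)
  | c (p₁ : Option Bool)
  | d
  deriving DecidableEq, Fintype

/-- Transition of `appendT` (see `App`). [folklore] -/
def appStep : App → Bool → App × List Bool
  | .a none p₂, c => (.a (some c) p₂, [])
  | .a (some c') p₂, c =>
    if c' = c then
      match p₂ with
      | none => (.a none (some c), [])
      | some t => if t = c then (.a none none, [t, t]) else (.b none, [false, true, true, true])
    else (.d, [])
  | .b none, c => (.b (some c), [])
  | .b (some c'), c => if c' = c then (.b none, [c]) else (.c none, [])
  | .c none, c => (.c (some c), [])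
  | .c (some c'), c => if c' = c then (.c none, [c, c]) else (.d, [false, true])
  | .d, _ => (.d, [])

/-- **The append transducer**: `⟨⟨x, L⟩, ⟨Y, []⟩⟩ ↦ ⟨x, 1 1 L ++ Y Y 0 1⟩` (`appendT_eval`) — with
`L = listBool fAns` this is `⟨x, listBool (fAns ++ [Y])⟩` (`listBool_encode_append_singleton`):
one more answer in the transcript of the outer machine. [Arora–Barak 2009, §0.1, §1.3] [folklore] -/
def appendT : FST App Bool Bool where
  init := .a none none
  step := appStep
  front := fun _ => []
  keep := fun _ => true

/-- The transition function (definitional). [folklore] -/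
@[simp] theorem appendT_step (s : App) (c : Bool) : appendT.step s c = appStep s c := rfl

/-- Phase lemma of the transducer. [folklore] -/
theorem appendT_run_d (l : List Bool) : (appendT.run .d l).2 = [] := by
  induction l with
  | nil => rfl
  | cons c l ih => simp [FST.run_cons, appStep, ih]

/-- Phase `a` on the quadrupled bits of `x`. [folklore] -/
theorem appendT_run_a (x rest : List Bool) :
    appendT.run (.a none none) (dup (dup x) ++ rest) =
      ((appendT.run (.a none none) rest).1, dup x ++ (appendT.run (.a none none) rest).2) := by
  induction x with
  | nil => simp [dup]
  | cons b x ih =>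
    simp only [dup, List.flatMap_cons, List.cons_append, List.nil_append] at ih ⊢
    simp [FST.run_cons, appStep, ih]

/-- Phase `b` copies the recovered symbols. [folklore] -/
theorem appendT_run_b (L rest : List Bool) :
    appendT.run (.b none) (dup L ++ rest) =
      ((appendT.run (.b none) rest).1, L ++ (appendT.run (.b none) rest).2) := by
  induction L with
  | nil => simp [dup]
  | cons b L ih =>
    simp only [dup, List.flatMap_cons, List.cons_append, List.nil_append] at ih ⊢
    simp [FST.run_cons, appStep, ih]

/-- Phase `c` doubles the second field. [folklore] -/
theorem appendT_run_c (Y rest : List Bool) :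
    appendT.run (.c none) (dup Y ++ rest) =
      ((appendT.run (.c none) rest).1, dup Y ++ (appendT.run (.c none) rest).2) := by
  induction Y with
  | nil => simp [dup]
  | cons b Y ih =>
    simp only [dup, List.flatMap_cons, List.cons_append, List.nil_append] at ih ⊢
    simp [FST.run_cons, appStep, ih]

/-- **`appendT ⟨⟨x, L⟩, ⟨Y, []⟩⟩ = ⟨x, 1 1 L ++ Y Y 0 1⟩`.** [folklore] -/
theorem appendT_eval (x L Y : List Bool) :
    appendT.eval (boolPair (boolPair x L) (boolPair Y [])) =
      boolPair x (true :: true :: L ++ (dup Y ++ [false, true])) := by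
  have he : ∀ w, appendT.eval w = (appendT.run (.a none none) w).2 := fun w => by
    simp [FST.eval, appendT]
  rw [he]
  have h1 : boolPair (boolPair x L) (boolPair Y []) =
      dup (dup x) ++ (false :: false :: true :: true ::
        (dup L ++ (false :: true :: (dup Y ++ [false, true])))) := by
    simp [boolPair_eq_dup, dup, List.append_assoc]
  rw [h1, appendT_run_a]
  simp only [FST.run_cons, appendT_step, appStep, ↓reduceIte, Bool.false_eq_true]
  rw [appendT_run_b]
  simp only [FST.run_cons, appendT_step, appStep, ↓reduceIte, Bool.false_eq_true]
  rw [appendT_run_c]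
  simp [FST.run_cons, appStep, boolPair_eq_dup]

/-! ### Moving the next answer into the transcript of `N`: `⟨⟨u, K⟩, ⟨⟨a, R⟩, []⟩⟩ ↦ ⟨⟨u, 11 K a a 01⟩, R⟩` -/

/-- States of `moveBlkT`: `a` — quadrupling `u`; `b` — doubling the rest `K` of the first field;
`c` — quadrupling the head block `a` of the second field; `d` — copying the rest `R` of the
second field; `e` — done. [folklore] -/
inductive Mv
  | a (p₁ p₂ : Option Bool)
  | b (p₁ : Option Bool)
  | c (p₁ p₂ : Option Bool)
  | d (p₁ : Option Bool)
  | e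
  deriving DecidableEq, Fintype

/-- Transition of `moveBlkT` (see `Mv`). [folklore] -/
def mvStep : Mv → Bool → Mv × List Bool
  | .a none p₂, c => (.a (some c) p₂, [])
  | .a (some c') p₂, c =>
    if c' = c then
      match p₂ with
      | none => (.a none (some c), [])
      | some t => if t = c then (.a none none, [t, t, t, t])
          else (.b none, [false, false, true, true, true, true, true, true])
    else (.e, [])
  | .b none, c => (.b (some c), [])
  | .b (some c'), c => if c' = c then (.b none, [c, c]) else (.c none none, [])
  | .c none p₂, c => (.c (some c) p₂, [])
  | .c (some c') p₂, c =>
    if c' = c then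
      match p₂ with
      | none => (.c none (some c), [])
      | some t => if t = c then (.c none none, [t, t, t, t])
          else (.d none, [false, false, true, true, false, true])
    else (.e, [])
  | .d none, c => (.d (some c), [])
  | .d (some c'), c => if c' = c then (.d none, [c]) else (.e, [])
  | .e, _ => (.e, [])

/-- **The move transducer**: `⟨⟨u, K⟩, ⟨⟨a, R⟩, []⟩⟩ ↦ ⟨⟨u, 1 1 K ++ a a 0 1⟩, R⟩`
(`moveBlkT_eval`): the head block `a` of the unconsumed answers becomes one more answer in the
transcript `K = listBool nAns` of the inner machine. [Arora–Barak 2009, §0.1, §1.3] [folklore] -/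
def moveBlkT : FST Mv Bool Bool where
  init := .a none none
  step := mvStep
  front := fun _ => []
  keep := fun _ => true

/-- The transition function (definitional). [folklore] -/
@[simp] theorem moveBlkT_step (s : Mv) (c : Bool) : moveBlkT.step s c = mvStep s c := rfl

/-- Phase lemma of the transducer. [folklore] -/
theorem moveBlkT_run_e (l : List Bool) : (moveBlkT.run .e l).2 = [] := by
  induction l with
  | nil => rfl
  | cons c l ih => simp [FST.run_cons, mvStep, ih]

/-- Phase lemma of the transducer. [folklore] -/
theorem moveBlkT_run_a (u rest : List Bool) :
    moveBlkT.run (.a none none) (dup (dup u) ++ rest) =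
      ((moveBlkT.run (.a none none) rest).1, dup (dup u) ++ (moveBlkT.run (.a none none) rest).2) := by
  induction u with
  | nil => simp [dup]
  | cons b u ih =>
    simp only [dup, List.flatMap_cons, List.cons_append, List.nil_append] at ih ⊢
    simp [FST.run_cons, mvStep, ih]

/-- Phase lemma of the transducer. [folklore] -/
theorem moveBlkT_run_b (K rest : List Bool) :
    moveBlkT.run (.b none) (dup K ++ rest) =
      ((moveBlkT.run (.b none) rest).1, dup K ++ (moveBlkT.run (.b none) rest).2) := by
  induction K with
  | nil => simp [dup]
  | cons b K ih =>
    simp only [dup, List.flatMap_cons, List.cons_append, List.nil_append] at ih ⊢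
    simp [FST.run_cons, mvStep, ih]

/-- Phase lemma of the transducer. [folklore] -/
theorem moveBlkT_run_c (a rest : List Bool) :
    moveBlkT.run (.c none none) (dup (dup a) ++ rest) =
      ((moveBlkT.run (.c none none) rest).1, dup (dup a) ++ (moveBlkT.run (.c none none) rest).2) := by
  induction a with
  | nil => simp [dup]
  | cons b a ih =>
    simp only [dup, List.flatMap_cons, List.cons_append, List.nil_append] at ih ⊢
    simp [FST.run_cons, mvStep, ih]

/-- Phase lemma of the transducer. [folklore] -/
theorem moveBlkT_run_d (R rest : List Bool) :
    moveBlkT.run (.d none) (dup R ++ rest) =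
      ((moveBlkT.run (.d none) rest).1, R ++ (moveBlkT.run (.d none) rest).2) := by
  induction R with
  | nil => simp [dup]
  | cons b R ih =>
    simp only [dup, List.flatMap_cons, List.cons_append, List.nil_append] at ih ⊢
    simp [FST.run_cons, mvStep, ih]

/-- **`moveBlkT ⟨⟨u, K⟩, ⟨⟨a, R⟩, []⟩⟩ = ⟨⟨u, 1 1 K ++ a a 0 1⟩, R⟩`.** [folklore] -/
theorem moveBlkT_eval (u K a R : List Bool) :
    moveBlkT.eval (boolPair (boolPair u K) (boolPair (boolPair a R) [])) =
      boolPair (boolPair u (true :: true :: K ++ (dup a ++ [false, true]))) R := by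
  have he : ∀ w, moveBlkT.eval w = (moveBlkT.run (.a none none) w).2 := fun w => by
    simp [FST.eval, moveBlkT]
  rw [he]
  have h1 : boolPair (boolPair u K) (boolPair (boolPair a R) []) =
      dup (dup u) ++ (false :: false :: true :: true ::
        (dup K ++ (false :: true :: (dup (dup a) ++ (false :: false :: true :: true ::
          (dup R ++ [false, true])))))) := by
    simp [boolPair_eq_dup, dup, List.append_assoc]
  rw [h1, moveBlkT_run_a]
  simp only [FST.run_cons, moveBlkT_step, mvStep, ↓reduceIte, Bool.false_eq_true]
  rw [moveBlkT_run_b]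
  simp only [FST.run_cons, moveBlkT_step, mvStep, ↓reduceIte, Bool.false_eq_true]
  rw [moveBlkT_run_c]
  simp only [FST.run_cons, moveBlkT_step, mvStep, ↓reduceIte, Bool.false_eq_true]
  rw [moveBlkT_run_d]
  simp [FST.run_cons, mvStep, boolPair_eq_dup, dup, List.append_assoc]

/-- The `listBool` code of a transcript with one more answer: `listBool (l ++ [y]) = 1 1 L ++ y y 0 1`
for `L = listBool l`. [H21 design C2] [folklore] -/
theorem listBool_encode_append_singleton (l : List (List Bool)) (y : List Bool) :
    (encodingList Bool).listBool.encode (l ++ [y]) =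
      true :: true :: (encodingList Bool).listBool.encode l ++ (dup y ++ [false, true]) := by
  have hfold : ∀ (l : List (List Bool)) (Z : List Bool),
      l.foldr (fun a acc => boolPair a acc) Z = l.foldr (fun a acc => boolPair a acc) [] ++ Z := by
    intro l Z
    induction l with
    | nil => rfl
    | cons a l ih =>
      rw [List.foldr_cons, List.foldr_cons, ih, boolPair_eq_dup, boolPair_eq_dup]
      simp [List.append_assoc]
  change boolPair (unaryEncodeNat (l ++ [y]).length) ((l ++ [y]).foldr (fun a acc => boolPair a acc) []) =
    true :: true :: boolPair (unaryEncodeNat l.length) (l.foldr (fun a acc => boolPair a acc) []) ++ _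
  rw [List.foldr_append, List.length_append, List.length_singleton, hfold]
  simp [unaryEncodeNat, boolPair_eq_dup, dup, List.append_assoc]

end OCM

/-! ## The machine layer -/

namespace OracleComposition

open OCM StrCopy

variable {β : Type} (eb : Encoding β Bool)

/-! ### The tape encoding of states -/

/-- Length of one unit of fuel on the tape: an active half-step lengthens the data fields by at
most `2 · bnd + 4` symbols (doubled), which is what one unit pays for. [folklore] -/
def chunk (bnd : ℕ) : ℕ := 2 * bnd + 4

/-- Two-bit code of the control phase. [folklore] -/
def phCode : Phase β → List Bool
  | .runM => [false, false]
  | .runN => [false, true]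
  | .doneQuery => [true, false]
  | .doneOut _ => [true, true]

/-- The result field: the code of the output in phase `doneOut b`, empty otherwise. [folklore] -/
def resCode : Phase β → List Bool
  | .doneOut b => eb.encode b
  | _ => []

/-- The code of step-function arguments `(input, answers)`, as in `OracleAlg.IsPolyTime`.
[Arora–Barak 2009, §3.4] [folklore] -/
def encA (x : List Bool) (l : List (List Bool)) : List Bool :=
  boolPair x ((encodingList Bool).listBool.encode l)

/-- The unconsumed answers as consecutive self-delimited blocks (the body of their `listBool`
code, without the length header). [folklore] -/
def blocks (l : List (List Bool)) : List Bool :=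
  l.foldr (fun a acc => boolPair a acc) []

/-- Unfolding on a pair code (definitional). [folklore] -/
@[simp] theorem blocks_nil : blocks [] = [] := rfl
/-- Unfolding on a pair code (definitional). [folklore] -/
@[simp] theorem blocks_cons (a : List Bool) (l : List (List Bool)) :
    blocks (a :: l) = boolPair a (blocks l) := rfl

/-- The bound/fuel field `⟨1^bnd, 1^(pad · chunk bnd)⟩`. [folklore] -/
def encPB (bnd pad : ℕ) : List Bool :=
  boolPair (ones bnd) (ones (pad * chunk bnd))

/-- **The tape encoding of a state**: the right-nested tuple
`⟨phase, ⟨⟨1^bnd, 1^fuel⟩, ⟨⟨x, listBool fAns⟩, ⟨⟨u, listBool nAns⟩, ⟨blocks rest, ⟨out, res⟩⟩⟩⟩⟩⟩`.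
[folklore] -/
def enc (s : State β) : List Bool :=
  boolPair (phCode s.phase) (boolPair (encPB s.bnd s.pad) (boolPair (encA s.x s.fAns)
    (boolPair (encA s.u s.nAns) (boolPair (blocks s.rest) (boolPair s.out (resCode eb s.phase))))))

/-- The code of the results of the outer step function. [folklore] -/
def encOutM (r : List Bool ⊕ β) : List Bool :=
  ((encodingList Bool).sumBool eb).encode r

/-- The tagged code of a step result (definitional). [folklore] -/
@[simp] theorem encOutM_inl (q : List Bool) : encOutM eb (Sum.inl q) = false :: q := rfl
/-- The tagged code of a step result (definitional). [folklore] -/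
@[simp] theorem encOutM_inr (b : β) : encOutM eb (Sum.inr b) = true :: eb.encode b := rfl

/-- The code of the results of the inner step function. [folklore] -/
def encOutN (r : List Bool ⊕ List Bool) : List Bool :=
  ((encodingList Bool).sumBool (encodingList Bool)).encode r

/-- The tagged code of a step result (definitional). [folklore] -/
@[simp] theorem encOutN_inl (q : List Bool) : encOutN (Sum.inl q) = false :: q := rfl
/-- The tagged code of a step result (definitional). [folklore] -/
@[simp] theorem encOutN_inr (y : List Bool) : encOutN (Sum.inr y) = true :: y := rfl

/-! ### The bookkeeping after a step of `M`, as a string function -/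

section PostM

open Polynomial

/-- On input `⟨R, S⟩` (result code, state code): the payload of the result. [folklore] -/
def payloadF : List Bool → List Bool := List.tail ∘ fstP

/-- The clamp bound field `1^bnd`. [folklore] -/
def bndF : List Bool → List Bool := fstP ∘ fld 2

/-- The fuel field. [folklore] -/
def padF : List Bool → List Bool := sndP ∘ fld 2

/-- The clamped payload `payload ↾ bnd`. [folklore] -/
noncomputable def clampF : List Bool → List Bool := sndP ∘ truncSndFn X ∘ pairFn bndF payloadF

/-- The length test `[ |payload| ≤ bnd ]`. [folklore] -/
noncomputable def lenOkF : List Bool → List Bool := lenLeFn X ∘ pairFn bndF payloadF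

/-- The bound/fuel field after paying one unit. [folklore] -/
noncomputable def decPBF : List Bool → List Bool := dropSndFn (2 * X + 4) ∘ fld 2

/-- Is the `M`-half active (phase `runM` = code `00`, fuel left)? [folklore] -/
def actM (p₁ p₂ pe : Option Bool) : Bool := (p₁ == some false) && (p₂ == some false) && pe.isSome

/-- Selector: the result is a query (replace the transcript of `N`). [folklore] -/
def selANM (p₁ p₂ tg pe : Option Bool) : Bool := actM p₁ p₂ pe && (tg == some false)

/-- Selector: the result is an output whose code fits (store it). [folklore] -/
def selRESM (p₁ p₂ tg lb pe : Option Bool) : Bool :=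
  actM p₁ p₂ pe && !(tg == some false) && (lb == some true)

/-- The new phase code after a step of `M`. [folklore] -/
def phM (p₁ p₂ tg lb pe : Option Bool) : List Bool :=
  if actM p₁ p₂ pe then
    (if tg == some false then [false, true] else if lb == some true then [true, true] else [true, false])
  else [p₁.getD false, p₂.getD false]

/-- Decision table after a step of `M`, on the first symbols of
(phase, phase tail, result, length test, fuel): new phase code and the selector bits
`⟨PH', ⟨[selAN], ⟨[selRES], ⟨[act], []⟩⟩⟩⟩`. [folklore] -/
def tblM (p₁ p₂ tg lb pe : Option Bool) : List Bool :=
  boolPair (phM p₁ p₂ tg lb pe) (boolPair [selANM p₁ p₂ tg pe] (boolPair [selRESM p₁ p₂ tg lb pe]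
    (boolPair [actM p₁ p₂ pe] [])))

/-- Fields of the decision table. [folklore] -/
theorem fld_tblM (p₁ p₂ tg lb pe : Option Bool) :
    fld 0 (tblM p₁ p₂ tg lb pe) = phM p₁ p₂ tg lb pe ∧ fld 1 (tblM p₁ p₂ tg lb pe) = [selANM p₁ p₂ tg pe] ∧
    fld 2 (tblM p₁ p₂ tg lb pe) = [selRESM p₁ p₂ tg lb pe] ∧ fld 3 (tblM p₁ p₂ tg lb pe) = [actM p₁ p₂ pe] := by
  simp [tblM]

/-- The flags after a step of `M`. [folklore] -/
noncomputable def flagsMF : List Bool → List Bool :=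
  (probeT tblM).eval ∘
    pairFn (fld 1) (pairFn (List.tail ∘ fld 1) (pairFn fstP (pairFn lenOkF (pairFn padF fun _ => []))))

/-- **The bookkeeping after a step of `M`** as a string function on `⟨R, S⟩`: the new state code
(`postMF_spec`). [folklore] -/
noncomputable def postMF : List Bool → List Bool :=
  pairFn (fld 0 ∘ flagsMF)
    (pairFn (iteFn (fld 3 ∘ flagsMF) decPBF (fld 2))
      (pairFn (fld 3)
        (pairFn (iteFn (fld 1 ∘ flagsMF) (pairFn clampF fun _ => [false, true]) (fld 4))
          (pairFn (fld 5) (pairFn (fld 6) (iteFn (fld 2 ∘ flagsMF) payloadF (sndIter 7)))))))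

/-- `payloadF` is in `FP`. [folklore] -/
theorem payloadF_mem_FP : payloadF ∈ FP := comp_mem_FP PRelSigma.tail_mem_FP fstP_mem_FP
/-- `bndF` is in `FP`. [folklore] -/
theorem bndF_mem_FP : bndF ∈ FP := comp_mem_FP fstP_mem_FP (fld_mem_FP 2)
/-- `padF` is in `FP`. [folklore] -/
theorem padF_mem_FP : padF ∈ FP := comp_mem_FP sndP_mem_FP (fld_mem_FP 2)
/-- `clampF` is in `FP`. [folklore] -/
theorem clampF_mem_FP : clampF ∈ FP :=
  comp_mem_FP sndP_mem_FP (comp_mem_FP (truncSndFn_mem_FP X) (pairFn_mem_FP bndF_mem_FP payloadF_mem_FP))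
/-- `lenOkF` is in `FP`. [folklore] -/
theorem lenOkF_mem_FP : lenOkF ∈ FP :=
  comp_mem_FP (lenLeFn_mem_FP X) (pairFn_mem_FP bndF_mem_FP payloadF_mem_FP)
/-- `decPBF` is in `FP`. [folklore] -/
theorem decPBF_mem_FP : decPBF ∈ FP := comp_mem_FP (dropSndFn_mem_FP _) (fld_mem_FP 2)
/-- `flagsMF` is in `FP`. [folklore] -/
theorem flagsMF_mem_FP : flagsMF ∈ FP :=
  comp_mem_FP (probeT tblM).polyTimeComputable_eval
    (pairFn_mem_FP (fld_mem_FP 1) (pairFn_mem_FP (comp_mem_FP PRelSigma.tail_mem_FP (fld_mem_FP 1))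
      (pairFn_mem_FP fstP_mem_FP (pairFn_mem_FP lenOkF_mem_FP (pairFn_mem_FP padF_mem_FP (const_mem_FP _))))))

/-- `postMF ∈ FP`. [Arora–Barak 2009, Claim 1.6] [folklore] -/
theorem postMF_mem_FP : postMF ∈ FP :=
  pairFn_mem_FP (comp_mem_FP (fld_mem_FP 0) flagsMF_mem_FP)
    (pairFn_mem_FP (iteFn_mem_FP (comp_mem_FP (fld_mem_FP 3) flagsMF_mem_FP) decPBF_mem_FP (fld_mem_FP 2))
      (pairFn_mem_FP (fld_mem_FP 3)
        (pairFn_mem_FP (iteFn_mem_FP (comp_mem_FP (fld_mem_FP 1) flagsMF_mem_FP)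
            (pairFn_mem_FP clampF_mem_FP (const_mem_FP _)) (fld_mem_FP 4))
          (pairFn_mem_FP (fld_mem_FP 5) (pairFn_mem_FP (fld_mem_FP 6)
            (iteFn_mem_FP (comp_mem_FP (fld_mem_FP 2) flagsMF_mem_FP) payloadF_mem_FP (sndIter_mem_FP 7)))))))

/-- Values of the basic components on `⟨t :: P, enc s⟩`. [folklore] -/
theorem components_apply (t : Bool) (P : List Bool) (s : State β) :
    payloadF (boolPair (t :: P) (enc eb s)) = P ∧
    bndF (boolPair (t :: P) (enc eb s)) = ones s.bnd ∧
    padF (boolPair (t :: P) (enc eb s)) = ones (s.pad * chunk s.bnd) ∧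
    clampF (boolPair (t :: P) (enc eb s)) = P.take s.bnd ∧
    lenOkF (boolPair (t :: P) (enc eb s)) = [decide (P.length ≤ s.bnd)] ∧
    decPBF (boolPair (t :: P) (enc eb s)) = encPB s.bnd (s.pad - 1) := by
  have hb : bndF (boolPair (t :: P) (enc eb s)) = ones s.bnd := by simp [bndF, enc, encPB, fld, sndIter]
  have hp : payloadF (boolPair (t :: P) (enc eb s)) = P := by simp [payloadF]
  refine ⟨hp, hb, by simp [padF, enc, encPB, fld, sndIter], ?_, ?_, ?_⟩
  · simp only [clampF, Function.comp_apply, pairFn_apply, hb, hp, truncSndFn_boolPair, eval_X,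
      sndP_boolPair, ones, List.length_replicate]
  · simp only [lenOkF, Function.comp_apply, pairFn_apply, hb, hp, lenLeFn_boolPair, eval_X, ones,
      List.length_replicate]
  · simp only [decPBF, Function.comp_apply, enc, encPB, fld_succ_boolPair, fld_zero_boolPair,
      dropSndFn_boolPair, eval_add, eval_mul, eval_ofNat, eval_X, ones, List.length_replicate,
      List.drop_replicate, chunk]
    congr 2
    rw [Nat.sub_one_mul]

/-- The flags on `⟨t :: P, enc s⟩`. [folklore] -/
theorem flagsMF_apply (t : Bool) (P : List Bool) (s : State β) :
    flagsMF (boolPair (t :: P) (enc eb s)) =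
      tblM (phCode s.phase).head? (phCode s.phase).tail.head? (some t)
        (some (decide (P.length ≤ s.bnd))) (ones (s.pad * chunk s.bnd)).head? := by
  obtain ⟨hp, hb, hpad, hcl, hlen, hdec⟩ := components_apply eb t P s
  have hph : fld 1 (boolPair (t :: P) (enc eb s)) = phCode s.phase := by simp [enc]
  simp only [flagsMF, Function.comp_apply, pairFn_apply, hph, fstP_boolPair, hlen, hpad, probeT_eval,
    List.head?_cons]

/-- Head of a block of `1`s: `none` iff the block is empty. [folklore] -/
theorem head?_ones (n : ℕ) : (ones n).head? = if n = 0 then none else some true := by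
  cases n <;> simp [ones, List.replicate_succ]

/-- `chunk bnd ≠ 0`. [folklore] -/
theorem chunk_pos (bnd : ℕ) : 0 < chunk bnd := by unfold chunk; omega

/-- **The bookkeeping string function realises `stepM`**: on `⟨code of r, code of s⟩` it
produces the code of `stepM eb s r`. [folklore] -/
theorem postMF_spec (s : State β) (r : List Bool ⊕ β) :
    postMF (boolPair (encOutM eb r) (enc eb s)) = enc eb (stepM eb s r) := by
  -- the result code is a tagged payload
  obtain ⟨t, P, hr⟩ : ∃ (t : Bool) (P : List Bool), encOutM eb r = t :: P := by
    cases r with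
    | inl q => exact ⟨false, q, rfl⟩
    | inr b => exact ⟨true, eb.encode b, rfl⟩
  rw [hr]
  obtain ⟨hp, hb, hpad, hcl, hlen, hdec⟩ := components_apply eb t P s
  have hfl := flagsMF_apply eb t P s
  -- evaluate all components of `postMF`
  have hf0 : fld 0 (boolPair (t :: P) (enc eb s)) = t :: P := by simp
  have hf2 : fld 2 (boolPair (t :: P) (enc eb s)) = encPB s.bnd s.pad := by simp [enc]
  have hf3 : fld 3 (boolPair (t :: P) (enc eb s)) = encA s.x s.fAns := by simp [enc]
  have hf4 : fld 4 (boolPair (t :: P) (enc eb s)) = encA s.u s.nAns := by simp [enc]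
  have hf5 : fld 5 (boolPair (t :: P) (enc eb s)) = blocks s.rest := by simp [enc]
  have hf6 : fld 6 (boolPair (t :: P) (enc eb s)) = s.out := by simp [enc]
  have hf7 : sndIter 7 (boolPair (t :: P) (enc eb s)) = resCode eb s.phase := by simp [enc, sndIter]
  obtain ⟨ht0, ht1, ht2, ht3⟩ := fld_tblM (phCode s.phase).head? (phCode s.phase).tail.head? (some t)
    (some (decide (P.length ≤ s.bnd))) (ones (s.pad * chunk s.bnd)).head?
  have hs1 : (fld 1 ∘ flagsMF) (boolPair (t :: P) (enc eb s)) =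
      [selANM (phCode s.phase).head? (phCode s.phase).tail.head? (some t) (ones (s.pad * chunk s.bnd)).head?] := by
    rw [Function.comp_apply, hfl, ht1]
  have hs2 : (fld 2 ∘ flagsMF) (boolPair (t :: P) (enc eb s)) =
      [selRESM (phCode s.phase).head? (phCode s.phase).tail.head? (some t)
        (some (decide (P.length ≤ s.bnd))) (ones (s.pad * chunk s.bnd)).head?] := by
    rw [Function.comp_apply, hfl, ht2]
  have hs3 : (fld 3 ∘ flagsMF) (boolPair (t :: P) (enc eb s)) =
      [actM (phCode s.phase).head? (phCode s.phase).tail.head? (ones (s.pad * chunk s.bnd)).head?] := by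
    rw [Function.comp_apply, hfl, ht3]
  simp only [postMF, pairFn_apply, Function.comp_apply, hfl, ht0, iteFn_apply hs1, iteFn_apply hs2,
    iteFn_apply hs3, hf2, hf3, hf4, hf5, hf6, hf7, hcl, hp, hdec]
  -- case analysis on the state and the result
  obtain ⟨ph, x, fAns, u, nAns, rest, out, bnd, pad⟩ := s
  simp only at *
  rw [head?_ones]
  have hnil : (encodingList Bool).listBool.encode ([] : List (List Bool)) = [false, true] := rfl
  cases r with
  | inl q =>
    simp only [encOutM_inl, List.cons.injEq] at hr
    obtain ⟨rfl, rfl⟩ := hr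
    cases ph <;> cases pad <;>
      simp [phM, selANM, selRESM, actM, phCode, stepM, enc, resCode, encA, (chunk_pos bnd).ne', hnil]
  | inr b =>
    simp only [encOutM_inr, List.cons.injEq] at hr
    obtain ⟨rfl, rfl⟩ := hr
    by_cases hlenb : (eb.encode b).length ≤ bnd <;> cases ph <;> cases pad <;>
      simp [phM, selANM, selRESM, actM, phCode, stepM, enc, resCode, (chunk_pos bnd).ne', hlenb]

end PostM

/-! ### The bookkeeping after a step of `N`, as a string function -/

section PostN

open Polynomial

/-- A pair code is a nonempty string. [folklore] -/
theorem isSome_head?_boolPair (a X : List Bool) : (boolPair a X).head?.isSome = true := by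
  cases a <;> simp [boolPair]

/-- Is the `N`-half active (phase `runN` = code `01`, fuel left)? [folklore] -/
def actN (p₁ p₂ pe : Option Bool) : Bool := (p₁ == some false) && (p₂ == some true) && pe.isSome

/-- Selector: the result is an output (append it, reset the transcript of `N`). [folklore] -/
def selOutN (p₁ p₂ tg pe : Option Bool) : Bool := actN p₁ p₂ pe && (tg == some true)

/-- Selector: the result is a query and an answer is available (move it). [folklore] -/
def selMoveN (p₁ p₂ tg pe re : Option Bool) : Bool := actN p₁ p₂ pe && !(tg == some true) && re.isSome

/-- Selector: the result is a query and no answer is available (report it). [folklore] -/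
def selQueryN (p₁ p₂ tg pe re : Option Bool) : Bool := actN p₁ p₂ pe && !(tg == some true) && !re.isSome

/-- The new phase code after a step of `N`. [folklore] -/
def phN (p₁ p₂ tg pe re : Option Bool) : List Bool :=
  if actN p₁ p₂ pe then
    (if tg == some true then [false, false] else if re.isSome then [false, true] else [true, false])
  else [p₁.getD false, p₂.getD false]

/-- Decision table after a step of `N`, on the first symbols of
(phase, phase tail, result, fuel, unconsumed answers): new phase code and the selector bits
`⟨PH', ⟨[selOut], ⟨[selMove], ⟨[selQuery], ⟨[act], []⟩⟩⟩⟩⟩`. [folklore] -/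
def tblN (p₁ p₂ tg pe re : Option Bool) : List Bool :=
  boolPair (phN p₁ p₂ tg pe re) (boolPair [selOutN p₁ p₂ tg pe] (boolPair [selMoveN p₁ p₂ tg pe re]
    (boolPair [selQueryN p₁ p₂ tg pe re] (boolPair [actN p₁ p₂ pe] []))))

/-- Fields of the decision table. [folklore] -/
theorem fld_tblN (p₁ p₂ tg pe re : Option Bool) :
    fld 0 (tblN p₁ p₂ tg pe re) = phN p₁ p₂ tg pe re ∧ fld 1 (tblN p₁ p₂ tg pe re) = [selOutN p₁ p₂ tg pe] ∧
    fld 2 (tblN p₁ p₂ tg pe re) = [selMoveN p₁ p₂ tg pe re] ∧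
    fld 3 (tblN p₁ p₂ tg pe re) = [selQueryN p₁ p₂ tg pe re] ∧ fld 4 (tblN p₁ p₂ tg pe re) = [actN p₁ p₂ pe] := by
  simp [tblN]

/-- The flags after a step of `N`. [folklore] -/
noncomputable def flagsNF : List Bool → List Bool :=
  (probeT tblN).eval ∘
    pairFn (fld 1) (pairFn (List.tail ∘ fld 1) (pairFn fstP (pairFn padF (pairFn (fld 5) fun _ => []))))

/-- Appending the (clamped) answer to the transcript of `M`. [folklore] -/
noncomputable def appF : List Bool → List Bool :=
  appendT.eval ∘ pairFn (fld 3) (pairFn clampF fun _ => [])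

/-- Moving the next unconsumed answer into the transcript of `N`. [folklore] -/
noncomputable def mvF : List Bool → List Bool :=
  moveBlkT.eval ∘ pairFn (fld 4) (pairFn (fld 5) fun _ => [])

/-- **The bookkeeping after a step of `N`** as a string function on `⟨R, S⟩` (`postNF_spec`). [folklore] -/
noncomputable def postNF : List Bool → List Bool :=
  pairFn (fld 0 ∘ flagsNF)
    (pairFn (iteFn (fld 4 ∘ flagsNF) decPBF (fld 2))
      (pairFn (iteFn (fld 1 ∘ flagsNF) appF (fld 3))
        (pairFn (iteFn (fld 1 ∘ flagsNF) (fun _ => encA [] [])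
            (iteFn (fld 2 ∘ flagsNF) (fstP ∘ mvF) (fld 4)))
          (pairFn (iteFn (fld 2 ∘ flagsNF) (sndP ∘ mvF) (fld 5))
            (pairFn (iteFn (fld 3 ∘ flagsNF) clampF (fld 6)) (sndIter 7))))))

/-- `flagsNF` is in `FP`. [folklore] -/
theorem flagsNF_mem_FP : flagsNF ∈ FP :=
  comp_mem_FP (probeT tblN).polyTimeComputable_eval
    (pairFn_mem_FP (fld_mem_FP 1) (pairFn_mem_FP (comp_mem_FP PRelSigma.tail_mem_FP (fld_mem_FP 1))
      (pairFn_mem_FP fstP_mem_FP (pairFn_mem_FP padF_mem_FP (pairFn_mem_FP (fld_mem_FP 5) (const_mem_FP _))))))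
/-- `appF` is in `FP`. [folklore] -/
theorem appF_mem_FP : appF ∈ FP :=
  comp_mem_FP appendT.polyTimeComputable_eval
    (pairFn_mem_FP (fld_mem_FP 3) (pairFn_mem_FP clampF_mem_FP (const_mem_FP _)))
/-- `mvF` is in `FP`. [folklore] -/
theorem mvF_mem_FP : mvF ∈ FP :=
  comp_mem_FP moveBlkT.polyTimeComputable_eval
    (pairFn_mem_FP (fld_mem_FP 4) (pairFn_mem_FP (fld_mem_FP 5) (const_mem_FP _)))

/-- `postNF ∈ FP`. [Arora–Barak 2009, Claim 1.6] [folklore] -/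
theorem postNF_mem_FP : postNF ∈ FP :=
  pairFn_mem_FP (comp_mem_FP (fld_mem_FP 0) flagsNF_mem_FP)
    (pairFn_mem_FP (iteFn_mem_FP (comp_mem_FP (fld_mem_FP 4) flagsNF_mem_FP) decPBF_mem_FP (fld_mem_FP 2))
      (pairFn_mem_FP (iteFn_mem_FP (comp_mem_FP (fld_mem_FP 1) flagsNF_mem_FP) appF_mem_FP (fld_mem_FP 3))
        (pairFn_mem_FP (iteFn_mem_FP (comp_mem_FP (fld_mem_FP 1) flagsNF_mem_FP) (const_mem_FP _)
            (iteFn_mem_FP (comp_mem_FP (fld_mem_FP 2) flagsNF_mem_FP) (comp_mem_FP fstP_mem_FP mvF_mem_FP)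
              (fld_mem_FP 4)))
          (pairFn_mem_FP (iteFn_mem_FP (comp_mem_FP (fld_mem_FP 2) flagsNF_mem_FP)
              (comp_mem_FP sndP_mem_FP mvF_mem_FP) (fld_mem_FP 5))
            (pairFn_mem_FP (iteFn_mem_FP (comp_mem_FP (fld_mem_FP 3) flagsNF_mem_FP) clampF_mem_FP
              (fld_mem_FP 6)) (sndIter_mem_FP 7))))))

/-- The flags on `⟨t :: P, enc s⟩`. [folklore] -/
theorem flagsNF_apply (t : Bool) (P : List Bool) (s : State β) :
    flagsNF (boolPair (t :: P) (enc eb s)) =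
      tblN (phCode s.phase).head? (phCode s.phase).tail.head? (some t)
        (ones (s.pad * chunk s.bnd)).head? (blocks s.rest).head? := by
  obtain ⟨hp, hb, hpad, hcl, hlen, hdec⟩ := components_apply eb t P s
  have hph : fld 1 (boolPair (t :: P) (enc eb s)) = phCode s.phase := by simp [enc]
  have hrs : fld 5 (boolPair (t :: P) (enc eb s)) = blocks s.rest := by simp [enc]
  simp only [flagsNF, Function.comp_apply, pairFn_apply, hph, hrs, fstP_boolPair, hpad, probeT_eval,
    List.head?_cons]

/-- **The bookkeeping string function realises `stepN`**: on `⟨code of r, code of s⟩` it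
produces the code of `stepN s r`. [folklore] -/
theorem postNF_spec (s : State β) (r : List Bool ⊕ List Bool) :
    postNF (boolPair (encOutN r) (enc eb s)) = enc eb (stepN s r) := by
  obtain ⟨t, P, hr⟩ : ∃ (t : Bool) (P : List Bool), encOutN r = t :: P := by
    cases r with
    | inl q => exact ⟨false, q, rfl⟩
    | inr y => exact ⟨true, y, rfl⟩
  rw [hr]
  obtain ⟨hp, hb, hpad, hcl, hlen, hdec⟩ := components_apply eb t P s
  have hfl := flagsNF_apply eb t P s
  have hf2 : fld 2 (boolPair (t :: P) (enc eb s)) = encPB s.bnd s.pad := by simp [enc]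
  have hf3 : fld 3 (boolPair (t :: P) (enc eb s)) = encA s.x s.fAns := by simp [enc]
  have hf4 : fld 4 (boolPair (t :: P) (enc eb s)) = encA s.u s.nAns := by simp [enc]
  have hf5 : fld 5 (boolPair (t :: P) (enc eb s)) = blocks s.rest := by simp [enc]
  have hf6 : fld 6 (boolPair (t :: P) (enc eb s)) = s.out := by simp [enc]
  have hf7 : sndIter 7 (boolPair (t :: P) (enc eb s)) = resCode eb s.phase := by simp [enc, sndIter]
  have happ : appF (boolPair (t :: P) (enc eb s)) = encA s.x (s.fAns ++ [P.take s.bnd]) := by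
    simp only [appF, Function.comp_apply, pairFn_apply, hf3, hcl, encA, appendT_eval,
      listBool_encode_append_singleton]
  have hmv : ∀ (a : List Bool) (rest' : List (List Bool)), s.rest = a :: rest' →
      mvF (boolPair (t :: P) (enc eb s)) = boolPair (encA s.u (s.nAns ++ [a])) (blocks rest') := by
    intro a rest' hra
    simp only [mvF, Function.comp_apply, pairFn_apply, hf4, hf5, hra, blocks_cons, encA, moveBlkT_eval,
      listBool_encode_append_singleton]
  obtain ⟨ht0, ht1, ht2, ht3, ht4⟩ := fld_tblN (phCode s.phase).head? (phCode s.phase).tail.head? (some t)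
    (ones (s.pad * chunk s.bnd)).head? (blocks s.rest).head?
  have hs1 : (fld 1 ∘ flagsNF) (boolPair (t :: P) (enc eb s)) =
      [selOutN (phCode s.phase).head? (phCode s.phase).tail.head? (some t) (ones (s.pad * chunk s.bnd)).head?] := by
    rw [Function.comp_apply, hfl, ht1]
  have hs2 : (fld 2 ∘ flagsNF) (boolPair (t :: P) (enc eb s)) =
      [selMoveN (phCode s.phase).head? (phCode s.phase).tail.head? (some t) (ones (s.pad * chunk s.bnd)).head?
        (blocks s.rest).head?] := by
    rw [Function.comp_apply, hfl, ht2]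
  have hs3 : (fld 3 ∘ flagsNF) (boolPair (t :: P) (enc eb s)) =
      [selQueryN (phCode s.phase).head? (phCode s.phase).tail.head? (some t) (ones (s.pad * chunk s.bnd)).head?
        (blocks s.rest).head?] := by
    rw [Function.comp_apply, hfl, ht3]
  have hs4 : (fld 4 ∘ flagsNF) (boolPair (t :: P) (enc eb s)) =
      [actN (phCode s.phase).head? (phCode s.phase).tail.head? (ones (s.pad * chunk s.bnd)).head?] := by
    rw [Function.comp_apply, hfl, ht4]
  cases r with
  | inr y =>
    simp only [encOutN_inr, List.cons.injEq] at hr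
    obtain ⟨rfl, rfl⟩ := hr
    simp only [postNF, pairFn_apply, Function.comp_apply, hfl, ht0, iteFn_apply hs1, iteFn_apply hs2,
      iteFn_apply hs3, iteFn_apply hs4, hf2, hf3, hf4, hf5, hf6, hf7, hcl, hdec, happ]
    obtain ⟨ph, x, fAns, u, nAns, rest, out, bnd, pad⟩ := s
    simp only at *
    rw [head?_ones]
    cases ph <;> cases pad <;> cases rest <;>
      simp [phN, selOutN, selMoveN, selQueryN, actN, phCode, stepN, enc, resCode, (chunk_pos bnd).ne',
        isSome_head?_boolPair]
  | inl q =>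
    simp only [encOutN_inl, List.cons.injEq] at hr
    obtain ⟨rfl, rfl⟩ := hr
    rcases hrest : s.rest with _ | ⟨a, rest'⟩
    · simp only [postNF, pairFn_apply, Function.comp_apply, hfl, ht0, iteFn_apply hs1, iteFn_apply hs2,
        iteFn_apply hs3, iteFn_apply hs4, hf2, hf3, hf4, hf5, hf6, hf7, hcl, hdec, happ]
      obtain ⟨ph, x, fAns, u, nAns, rest, out, bnd, pad⟩ := s
      simp only at *
      subst hrest
      rw [head?_ones]
      cases ph <;> cases pad <;>
        simp [phN, selOutN, selMoveN, selQueryN, actN, phCode, stepN, enc, resCode, (chunk_pos bnd).ne']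
    · have hm := hmv a rest' hrest
      simp only [postNF, pairFn_apply, Function.comp_apply, hfl, ht0, iteFn_apply hs1, iteFn_apply hs2,
        iteFn_apply hs3, iteFn_apply hs4, hf2, hf3, hf4, hf5, hf6, hf7, hcl, hdec, happ, hm, fstP_boolPair,
        sndP_boolPair]
      obtain ⟨ph, x, fAns, u, nAns, rest, out, bnd, pad⟩ := s
      simp only at *
      subst hrest
      rw [head?_ones]
      cases ph <;> cases pad <;>
        simp [phN, selOutN, selMoveN, selQueryN, actN, phCode, stepN, enc, resCode, (chunk_pos bnd).ne',
          isSome_head?_boolPair]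

end PostN

/-! ### The micro-step does not lengthen the tape -/

section Growth

/-- Length of the code of step-function arguments. [folklore] -/
theorem length_encA (x : List Bool) (l : List (List Bool)) :
    (encA x l).length = 2 * x.length + 2 + (2 * l.length + 2 + (l.map fun a => 2 * a.length + 2).sum) := by
  rw [encA, length_boolPair, length_listBool_encode]

/-- Length of the block code of the unconsumed answers. [folklore] -/
theorem length_blocks (l : List (List Bool)) :
    (blocks l).length = (l.map fun a => 2 * a.length + 2).sum := length_foldr_boolPair l

/-- Length of the bound/fuel field. [folklore] -/
theorem length_encPB (bnd pad : ℕ) : (encPB bnd pad).length = 2 * bnd + 2 + pad * chunk bnd := by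
  simp [encPB, ones]

/-- The phase code has two symbols. [folklore] -/
@[simp] theorem length_phCode (ph : Phase β) : (phCode ph).length = 2 := by cases ph <;> rfl

/-- Length of the tape code of a state. [folklore] -/
theorem length_enc (s : State β) :
    (enc eb s).length = 6 + (2 * (encPB s.bnd s.pad).length + 2 + (2 * (encA s.x s.fAns).length + 2 +
      (2 * (encA s.u s.nAns).length + 2 + (2 * (blocks s.rest).length + 2 + (2 * s.out.length + 2 +
        (resCode eb s.phase).length))))) := by
  simp only [enc, length_boolPair, length_phCode]

/-- **The `M`-half does not lengthen the tape**: an active half-step pays one unit of fuel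
(`chunk bnd` symbols, doubled) for at most `2 · bnd + 4` new symbols (doubled). [folklore] -/
theorem length_enc_stepM_le (s : State β) (r : List Bool ⊕ β) :
    (enc eb (stepM eb s r)).length ≤ (enc eb s).length := by
  obtain ⟨ph, x, fAns, u, nAns, rest, out, bnd, pad⟩ := s
  cases ph <;> cases pad <;> cases r <;> simp only [stepM, le_refl]
  · -- query
    rw [length_enc, length_enc]
    simp only [length_encPB, length_encA, List.length_take, List.length_nil, List.map_nil,
      List.sum_nil, resCode, chunk, Nat.succ_mul]
    omega
  · -- output
    split
    · rw [length_enc, length_enc]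
      simp only [length_encPB, resCode, chunk, Nat.succ_mul, List.length_nil]
      omega
    · rw [length_enc, length_enc]
      simp only [length_encPB, resCode, chunk, Nat.succ_mul]
      omega

/-- **The `N`-half does not lengthen the tape.** [folklore] -/
theorem length_enc_stepN_le (s : State β) (r : List Bool ⊕ List Bool) :
    (enc eb (stepN s r)).length ≤ (enc eb s).length := by
  obtain ⟨ph, x, fAns, u, nAns, rest, out, bnd, pad⟩ := s
  cases ph <;> cases pad <;> cases r <;> simp only [stepN, le_refl]
  · -- query: move an answer or stop
    cases rest with
    | nil =>
      rw [length_enc, length_enc]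
      simp only [length_encPB, List.length_take, resCode, chunk, Nat.succ_mul]
      omega
    | cons a rest' =>
      rw [length_enc, length_enc]
      simp only [length_encPB, length_encA, length_blocks, List.map_append, List.sum_append,
        List.map_cons, List.sum_cons, List.map_nil, List.sum_nil, List.length_append,
        List.length_singleton, resCode, chunk, Nat.succ_mul]
      omega
  · -- output: append the answer
    rw [length_enc, length_enc]
    simp only [length_encPB, length_encA, List.map_append, List.sum_append, List.map_cons,
      List.sum_cons, List.map_nil, List.sum_nil, List.length_append, List.length_singleton,
      List.length_take, List.length_nil, resCode, chunk, Nat.succ_mul]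
    omega

variable (M : OracleAlg β) (N : OracleAlg (List Bool))

/-- **The micro-step does not lengthen the tape** (stated as `≤ … + 0`, the additive-growth
shape consumed by `PolyTimeComputable.iterate_of_le_add`). [folklore] -/
theorem length_enc_G_le (s : State β) : (enc eb (G M N eb s)).length ≤ (enc eb s).length + 0 := by
  rw [Nat.add_zero, G, GN, GM]
  exact (length_enc_stepN_le eb _ _).trans (length_enc_stepM_le eb _ _)

end Growth

end OracleComposition

namespace OracleComposition

open OCM StrCopy

variable {β : Type} (eb : Encoding β Bool) (M : OracleAlg β) (N : OracleAlg (List Bool))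

/-! ### The micro-step is polynomial-time -/

section Step

open PrePost

/-- Field format of (arguments of a step function, state). [folklore] -/
def enc1 (q : (List Bool × List (List Bool)) × State β) : List (Option Bool) :=
  (encA q.1.1 q.1.2).map some ++ none :: (enc eb q.2).map some

/-- Field format of (result of the outer step function, state). [folklore] -/
def enc2M (q : (List Bool ⊕ β) × State β) : List (Option Bool) :=
  (encOutM eb q.1).map some ++ none :: (enc eb q.2).map some

/-- Field format of (result of the inner step function, state). [folklore] -/
def enc2N (q : (List Bool ⊕ List Bool) × State β) : List (Option Bool) :=
  (encOutN q.1).map some ++ none :: (enc eb q.2).map some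

/-- Preparing the arguments of `M`: `S ↦ ⟨⟨x, listBool fAns⟩, S⟩` in field format. [folklore] -/
theorem polyTime_preM :
    PolyTimeComputable (enc eb) (enc1 eb) fun s : State β => ((s.x, s.fAns), s) := by
  have hS : PolyTimeComputable (id : List Bool → List Bool) (id : List (Option Bool) → _)
      (toField.eval ∘ pairFn (fld 2) id) :=
    PolyTimeComputable.comp_holds toField.polyTimeComputable_eval
      (pairFn_mem_FP (fld_mem_FP 2) (PolyTimeComputable.id _))
  refine hS.of_encode (enc eb) (fun _ => rfl) fun s => ?_
  simp [enc1, enc, toField_eval]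

/-- Preparing the arguments of `N`: `S ↦ ⟨⟨u, listBool nAns⟩, S⟩` in field format. [folklore] -/
theorem polyTime_preN :
    PolyTimeComputable (enc eb) (enc1 eb) fun s : State β => ((s.u, s.nAns), s) := by
  have hS : PolyTimeComputable (id : List Bool → List Bool) (id : List (Option Bool) → _)
      (toField.eval ∘ pairFn (fld 3) id) :=
    PolyTimeComputable.comp_holds toField.polyTimeComputable_eval
      (pairFn_mem_FP (fld_mem_FP 3) (PolyTimeComputable.id _))
  refine hS.of_encode (enc eb) (fun _ => rfl) fun s => ?_
  simp [enc1, enc, toField_eval]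

variable {eb M N}

/-- The step of `M` on the first field, the state kept as context
(`PolyTimeComputable.firstField`). [Arora–Barak 2009, §1.3 (subroutines)] [folklore] -/
theorem polyTime_stepFieldM (hM : M.IsPolyTime eb) :
    PolyTimeComputable (enc1 eb) (enc2M eb) (Prod.map (Function.uncurry M.step) id) :=
  (PolyTimeComputable.firstField (fun s : State β => (enc eb s).map some) hM).of_encode id
    (fun _ => rfl) (fun _ => rfl)

/-- The step of `N` on the first field, the state kept as context. [folklore] -/
theorem polyTime_stepFieldN (hN : N.IsPolyTime (encodingList Bool)) :
    PolyTimeComputable (enc1 eb) (enc2N eb) (Prod.map (Function.uncurry N.step) id) :=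
  (PolyTimeComputable.firstField (fun s : State β => (enc eb s).map some) hN).of_encode id
    (fun _ => rfl) (fun _ => rfl)

variable (eb)

/-- The bookkeeping after the step of `M` (`postMF_spec`). [folklore] -/
theorem polyTime_postM :
    PolyTimeComputable (enc2M eb) (enc eb) fun q : (List Bool ⊕ β) × State β => stepM eb q.2 q.1 := by
  have hS : PolyTimeComputable (id : List (Option Bool) → _) (id : List Bool → List Bool)
      (postMF ∘ fromField.eval) :=
    PolyTimeComputable.comp_holds postMF_mem_FP fromField.polyTimeComputable_eval
  refine hS.of_encode (enc2M eb) (fun _ => rfl) fun q => ?_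
  simp only [Function.comp_apply, enc2M, fromField_eval, id]
  exact postMF_spec eb q.2 q.1

/-- The bookkeeping after the step of `N` (`postNF_spec`). [folklore] -/
theorem polyTime_postN :
    PolyTimeComputable (enc2N eb) (enc eb) fun q : (List Bool ⊕ List Bool) × State β => stepN q.2 q.1 := by
  have hS : PolyTimeComputable (id : List (Option Bool) → _) (id : List Bool → List Bool)
      (postNF ∘ fromField.eval) :=
    PolyTimeComputable.comp_holds postNF_mem_FP fromField.polyTimeComputable_eval
  refine hS.of_encode (enc2N eb) (fun _ => rfl) fun q => ?_
  simp only [Function.comp_apply, enc2N, fromField_eval, id]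
  exact postNF_spec eb q.2 q.1

variable {eb}

/-- **The `M`-half of the micro-step is polynomial-time.** [folklore] -/
theorem polyTime_GM (hM : M.IsPolyTime eb) : PolyTimeComputable (enc eb) (enc eb) (GM M eb) :=
  (PolyTimeComputable.comp_holds (polyTime_postM eb)
    (PolyTimeComputable.comp_holds (polyTime_stepFieldM hM) (polyTime_preM eb))).of_encode id
    (fun _ => rfl) (fun _ => rfl)

/-- **The `N`-half of the micro-step is polynomial-time.** [folklore] -/
theorem polyTime_GN (hN : N.IsPolyTime (encodingList Bool)) :
    PolyTimeComputable (enc eb) (enc eb) (GN (β := β) N) :=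
  (PolyTimeComputable.comp_holds (polyTime_postN eb)
    (PolyTimeComputable.comp_holds (polyTime_stepFieldN hN) (polyTime_preN eb))).of_encode id
    (fun _ => rfl) (fun _ => rfl)

/-- **The micro-step is polynomial-time.** [folklore] -/
theorem polyTime_G (hM : M.IsPolyTime eb) (hN : N.IsPolyTime (encodingList Bool)) :
    PolyTimeComputable (enc eb) (enc eb) (G M N eb) :=
  (PolyTimeComputable.comp_holds (polyTime_GN hN) (polyTime_GM hM)).of_encode id (fun _ => rfl)
    (fun _ => rfl)

/-- **The clocked iteration of the micro-step is polynomial-time** (`TM2Iterate`). [folklore] -/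
theorem polyTime_iterate_G (hM : M.IsPolyTime eb) (hN : N.IsPolyTime (encodingList Bool)) :
    PolyTimeComputable (fun q : State β × ℕ => List.replicate q.2 none ++ (enc eb q.1).map some)
      (enc eb) (fun q => (G M N eb)^[q.2] q.1) :=
  PolyTimeComputable.iterate_of_le_add 0 (length_enc_G_le eb M N) (polyTime_G hM hN)

end Step

end OracleComposition

namespace OCM

open StrCopy

/-! ### Reading the result off the final state -/

/-- States of `readoutT`: reading the two doubled phase bits and the separator (`p0 … p5`),
skipping `k + 1` doubled fields (`skip k d pend`; `d`: the phase is `doneOut`), un-doubling the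
pending-query field (`outF`), copying the result field (`res`), done (`dead`). [folklore] -/
inductive Rd
  | p0
  | p1 (b : Bool)
  | p2 (b₁ : Bool)
  | p3 (b₁ b : Bool)
  | p4 (d : Bool)
  | p5 (d : Bool)
  | skip (k : Fin 5) (d : Bool) (pend : Option Bool)
  | outF (pend : Option Bool)
  | res
  | dead
  deriving DecidableEq, Fintype

/-- Transition of `readoutT` (see `Rd`). [folklore] -/
def rdStep : Rd → Bool → Rd × List Bool
  | .p0, b => (.p1 b, [])
  | .p1 b, _ => (.p2 b, [])
  | .p2 b₁, b => (.p3 b₁ b, [])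
  | .p3 b₁ b, _ => (.p4 (b₁ && b), [])
  | .p4 d, _ => (.p5 d, [])
  | .p5 d, _ => (.skip (if d then ⟨4, by omega⟩ else ⟨3, by omega⟩) d none, [d])
  | .skip k d none, c => (.skip k d (some c), [])
  | .skip k d (some c'), c =>
    if c' = c then (.skip k d none, [])
    else if h : k.val = 0 then (if d then .res else .outF none, [])
    else (.skip ⟨k.val - 1, by omega⟩ d none, [])
  | .outF none, c => (.outF (some c), [])
  | .outF (some c'), c => if c' = c then (.outF none, [c]) else (.dead, [])
  | .res, c => (.res, [c])
  | .dead, _ => (.dead, [])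

/-- **The readout transducer**: on the code of a state it writes the code of `readout s` —
the tagged output code in phase `doneOut`, the tagged pending query otherwise
(`readoutT_eval`). [folklore] -/
def readoutT : FST Rd Bool Bool where
  init := .p0
  step := rdStep
  front := fun _ => []
  keep := fun _ => true

/-- The transition function (definitional). [folklore] -/
@[simp] theorem readoutT_step (s : Rd) (b : Bool) : readoutT.step s b = rdStep s b := rfl

/-- Phase lemma of the transducer. [folklore] -/
theorem readoutT_run_dead (l : List Bool) : (readoutT.run .dead l).2 = [] := by
  induction l with
  | nil => rfl
  | cons b l ih => simp [FST.run_cons, rdStep, ih]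

/-- Phase lemma of the transducer. [folklore] -/
theorem readoutT_run_res (l : List Bool) : (readoutT.run .res l).2 = l := by
  induction l with
  | nil => rfl
  | cons b l ih => simp [FST.run_cons, rdStep, ih]

/-- Phase lemma of the transducer. [folklore] -/
theorem readoutT_run_outF (F rest : List Bool) :
    (readoutT.run (.outF none) (boolPair F rest)).2 = F := by
  rw [boolPair_eq_dup]
  induction F with
  | nil => simp [dup, FST.run_cons, rdStep, readoutT_run_dead]
  | cons c F ih =>
    simp only [dup, List.flatMap_cons, List.cons_append, List.nil_append] at ih ⊢
    simp [FST.run_cons, rdStep, ih]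

/-- Skipping a doubled field: nothing is emitted and the state after the separator is the
successor state. [folklore] -/
theorem readoutT_run_skip (k : ℕ) (hk : k < 5) (d : Bool) (F rest : List Bool) :
    readoutT.run (.skip ⟨k, hk⟩ d none) (boolPair F rest) =
      readoutT.run (if k = 0 then (if d then .res else .outF none) else .skip ⟨k - 1, by omega⟩ d none)
        rest := by
  rw [boolPair_eq_dup]
  induction F with
  | nil =>
    simp only [dup, List.flatMap_nil, List.nil_append, FST.run_cons, readoutT_step]
    rw [show rdStep (.skip ⟨k, hk⟩ d none) false = (.skip ⟨k, hk⟩ d (some false), []) from rfl]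
    simp only [List.nil_append]
    by_cases h0 : k = 0
    · subst h0; cases d <;> simp [rdStep]
    · simp [rdStep, h0]
  | cons c F ih =>
    simp only [dup, List.flatMap_cons, List.cons_append, List.nil_append] at ih ⊢
    rw [FST.run_cons, readoutT_step, show rdStep (.skip ⟨k, hk⟩ d none) c = (.skip ⟨k, hk⟩ d (some c), [])
      from rfl]
    simp only [List.nil_append]
    rw [FST.run_cons, readoutT_step, show rdStep (.skip ⟨k, hk⟩ d (some c)) c = (.skip ⟨k, hk⟩ d none, [])
      by simp [rdStep]]
    simpa using ih

end OCM

namespace OracleComposition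

open OCM StrCopy

variable {β : Type} (eb : Encoding β Bool)

/-- **`readoutT (enc s) = encOutM (readout s)`.** [folklore] -/
theorem readoutT_eval (s : State β) : readoutT.eval (enc eb s) = encOutM eb (readout s) := by
  have he : ∀ w, readoutT.eval w = (readoutT.run .p0 w).2 := fun w => by simp [FST.eval, readoutT]
  rw [he]
  obtain ⟨b₁, b₂, hph, hd⟩ : ∃ b₁ b₂ : Bool, phCode s.phase = [b₁, b₂] ∧
      (b₁ && b₂) = (match s.phase with | .doneOut _ => true | _ => false) := by
    cases s.phase <;> exact ⟨_, _, rfl, rfl⟩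
  have h1 : enc eb s = b₁ :: b₁ :: b₂ :: b₂ :: false :: true :: boolPair (encPB s.bnd s.pad)
      (boolPair (encA s.x s.fAns) (boolPair (encA s.u s.nAns) (boolPair (blocks s.rest)
        (boolPair s.out (resCode eb s.phase))))) := by
    simp [enc, hph, boolPair]
  rw [h1]
  simp only [FST.run_cons, readoutT_step, rdStep, List.nil_append, hd]
  cases hs : s.phase with
  | doneOut b =>
    simp only [↓reduceIte, List.singleton_append]
    rw [readoutT_run_skip 4 (by omega), if_neg (by omega)]
    simp only [show (4 : ℕ) - 1 = 3 from rfl]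
    rw [readoutT_run_skip 3 (by omega), if_neg (by omega)]
    simp only [show (3 : ℕ) - 1 = 2 from rfl]
    rw [readoutT_run_skip 2 (by omega), if_neg (by omega)]
    simp only [show (2 : ℕ) - 1 = 1 from rfl]
    rw [readoutT_run_skip 1 (by omega), if_neg (by omega)]
    simp only [show (1 : ℕ) - 1 = 0 from rfl]
    rw [readoutT_run_skip 0 (by omega), if_pos rfl]
    simp [readoutT_run_res, readout, hs, resCode]
  | runM | runN | doneQuery =>
    all_goals
      simp only [Bool.false_eq_true, ↓reduceIte, List.singleton_append]
      rw [readoutT_run_skip 3 (by omega), if_neg (by omega)]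
      simp only [show (3 : ℕ) - 1 = 2 from rfl]
      rw [readoutT_run_skip 2 (by omega), if_neg (by omega)]
      simp only [show (2 : ℕ) - 1 = 1 from rfl]
      rw [readoutT_run_skip 1 (by omega), if_neg (by omega)]
      simp only [show (1 : ℕ) - 1 = 0 from rfl]
      rw [readoutT_run_skip 0 (by omega), if_pos rfl]
      simp [readoutT_run_outF, readout, hs]

/-- **The readout is polynomial-time.** [folklore] -/
theorem polyTime_readout : PolyTimeComputable (enc eb) (encOutM eb) (readout (β := β)) :=
  readoutT.polyTimeComputable_eval.of_encode (enc eb) (fun _ => rfl) fun s => readoutT_eval eb s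

end OracleComposition

namespace OCM

open StrCopy

/-! ### Laying out the initial state -/

/-- Quadrupling. [folklore] -/
theorem dup_dup (x : List Bool) : dup (dup x) = x.flatMap fun b => [b, b, b, b] := by
  induction x with
  | nil => rfl
  | cons b x ih => simp [dup, List.flatMap_cons] at ih ⊢; exact ih

/-- States of the layout transducer `initT` (see `initT_eval` for the input format): `t0` the
iteration count; `t1` a terminator; `t2` skipping the doubled copy of the second header
string; `t3`/`t4` the bound and fuel blocks; `t5` skipping the doubled copy of the first header
string; `t6`/`t7` skipping its two blocks; `t8` the input `x` (quadrupled); `t9` skipping the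
length header of the answers; `t10` the answer blocks (doubled); `t11` done. [folklore] -/
inductive In
  | t0
  | t1
  | t2 (p : Option Bool)
  | t3
  | t4
  | t5 (p : Option Bool)
  | t6
  | t7
  | t8 (p₁ p₂ : Option Bool)
  | t9 (p₁ p₂ : Option Bool)
  | t10 (p : Option Bool)
  | t11
  deriving DecidableEq, Fintype

/-- Some-mapped words (abbreviation for the emissions of `initT`). [folklore] -/
def E (l : List Bool) : List (Option Bool) := l.map some

/-- The constant emitted between the input field and the answer blocks: end of `⟨x, listBool []⟩`,
its separator, the field `⟨[], listBool []⟩`, its separator. [folklore] -/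
def midConst : List Bool :=
  [false, false, true, true, false, false, true, true, false, true,
   false, false, true, true, false, false, true, true, false, true]

/-- Transition of `initT` (see `In`). [folklore] -/
def inStep : In → Bool → In × List (Option Bool)
  | .t0, true => (.t0, [none])
  | .t0, false => (.t1, [])
  | .t1, _ => (.t2 none, [])
  | .t2 none, c => (.t2 (some c), [])
  | .t2 (some c'), c => if c' = c then (.t2 none, [])
      else (.t3, E [false, false, false, false, false, true])
  | .t3, true => (.t3, E [true, true, true, true])
  | .t3, false => (.t4, E [false, false, true, true])
  | .t4, true => (.t4, E [true, true])
  | .t4, false => (.t5 none, E [false, true])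
  | .t5 none, c => (.t5 (some c), [])
  | .t5 (some c'), c => if c' = c then (.t5 none, []) else (.t6, [])
  | .t6, true => (.t6, [])
  | .t6, false => (.t7, [])
  | .t7, true => (.t7, [])
  | .t7, false => (.t8 none none, [])
  | .t8 none p₂, c => (.t8 (some c) p₂, [])
  | .t8 (some c') p₂, c =>
    if c' = c then
      match p₂ with
      | none => (.t8 none (some c), [])
      | some t => if t = c then (.t8 none none, E [t, t, t, t]) else (.t9 none none, E midConst)
    else (.t11, [])
  | .t9 none p₂, c => (.t9 (some c) p₂, [])
  | .t9 (some c') p₂, c =>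
    if c' = c then
      match p₂ with
      | none => (.t9 none (some c), [])
      | some t => if t = c then (.t9 none none, []) else (.t10 none, [])
    else (.t11, [])
  | .t10 none, c => (.t10 (some c), [])
  | .t10 (some c'), c => if c' = c then (.t10 none, E [c, c]) else (.t11, E [false, true, false, true])
  | .t11, _ => (.t11, [])

/-- **The layout transducer** producing the input word of the clocked iteration (iteration count
in unary as `none`s, then the code of the initial state) from the thrice-headered input
(`initT_eval`). [folklore] -/
def initT : FST In Bool (Option Bool) where
  init := .t0
  step := inStep
  front := fun _ => []
  keep := fun _ => true

/-- The transition function (definitional). [folklore] -/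
@[simp] theorem initT_step (s : In) (b : Bool) : initT.step s b = inStep s b := rfl

/-- Phase lemma of the transducer. [folklore] -/
theorem initT_run_t11 (l : List Bool) : (initT.run .t11 l).2 = [] := by
  induction l with
  | nil => rfl
  | cons b l ih => simp [FST.run_cons, inStep, ih]

/-- Phase lemma of the transducer. [folklore] -/
theorem initT_run_t0 (m : ℕ) (rest : List Bool) :
    initT.run .t0 (ones m ++ false :: rest) =
      ((initT.run .t1 rest).1, List.replicate m none ++ (initT.run .t1 rest).2) := by
  induction m with
  | zero => simp [ones, FST.run_cons, inStep]
  | succ m ih =>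
    simp only [ones, List.replicate_succ, List.cons_append] at ih ⊢
    simp [FST.run_cons, inStep, ih]

/-- Phase lemma of the transducer. [folklore] -/
theorem initT_run_t2 (S rest : List Bool) :
    initT.run (.t2 none) (dup S ++ false :: true :: rest) =
      ((initT.run .t3 rest).1,
        E [false, false, false, false, false, true] ++ (initT.run .t3 rest).2) := by
  induction S with
  | nil => simp [dup, FST.run_cons, inStep]
  | cons c S ih =>
    simp only [dup, List.flatMap_cons, List.cons_append, List.nil_append] at ih ⊢
    simp [FST.run_cons, inStep, ih]

/-- Phase lemma of the transducer. [folklore] -/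
theorem initT_run_t3 (m : ℕ) (rest : List Bool) :
    initT.run .t3 (ones m ++ false :: rest) =
      ((initT.run .t4 rest).1,
        E (dup (dup (ones m))) ++ E [false, false, true, true] ++ (initT.run .t4 rest).2) := by
  induction m with
  | zero => simp [ones, dup, E, FST.run_cons, inStep]
  | succ m ih =>
    simp only [ones, List.replicate_succ, List.cons_append] at ih ⊢
    simp [FST.run_cons, inStep, ih, dup, E]

/-- Phase lemma of the transducer. [folklore] -/
theorem initT_run_t4 (K : ℕ) (rest : List Bool) :
    initT.run .t4 (ones K ++ false :: rest) =
      ((initT.run (.t5 none) rest).1,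
        E (dup (ones K)) ++ E [false, true] ++ (initT.run (.t5 none) rest).2) := by
  induction K with
  | zero => simp [ones, dup, E, FST.run_cons, inStep]
  | succ K ih =>
    simp only [ones, List.replicate_succ, List.cons_append] at ih ⊢
    simp [FST.run_cons, inStep, ih, dup, E]

/-- Phase lemma of the transducer. [folklore] -/
theorem initT_run_t5 (S rest : List Bool) :
    initT.run (.t5 none) (dup S ++ false :: true :: rest) = initT.run .t6 rest := by
  induction S with
  | nil => simp [dup, FST.run_cons, inStep]
  | cons c S ih =>
    simp only [dup, List.flatMap_cons, List.cons_append, List.nil_append] at ih ⊢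
    simp [FST.run_cons, inStep, ih]

/-- Phase lemma of the transducer. [folklore] -/
theorem initT_run_t6 (m : ℕ) (rest : List Bool) :
    initT.run .t6 (ones m ++ false :: rest) = initT.run .t7 rest := by
  induction m with
  | zero => simp [ones, FST.run_cons, inStep]
  | succ m ih =>
    simp only [ones, List.replicate_succ, List.cons_append] at ih ⊢
    simp [FST.run_cons, inStep, ih]

/-- Phase lemma of the transducer. [folklore] -/
theorem initT_run_t7 (m : ℕ) (rest : List Bool) :
    initT.run .t7 (ones m ++ false :: rest) = initT.run (.t8 none none) rest := by
  induction m with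
  | zero => simp [ones, FST.run_cons, inStep]
  | succ m ih =>
    simp only [ones, List.replicate_succ, List.cons_append] at ih ⊢
    simp [FST.run_cons, inStep, ih]

/-- Phase lemma of the transducer. [folklore] -/
theorem initT_run_t8 (x rest : List Bool) :
    initT.run (.t8 none none) (dup (dup x) ++ rest) =
      ((initT.run (.t8 none none) rest).1, E (dup (dup x)) ++ (initT.run (.t8 none none) rest).2) := by
  induction x with
  | nil => simp [dup, E]
  | cons b x ih =>
    simp only [dup, List.flatMap_cons, List.cons_append, List.nil_append] at ih ⊢
    simp [FST.run_cons, inStep, ih, E]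

/-- Phase lemma of the transducer. [folklore] -/
theorem initT_run_t9 (u rest : List Bool) :
    initT.run (.t9 none none) (dup (dup u) ++ rest) = initT.run (.t9 none none) rest := by
  induction u with
  | nil => simp [dup]
  | cons b u ih =>
    simp only [dup, List.flatMap_cons, List.cons_append, List.nil_append] at ih ⊢
    simp [FST.run_cons, inStep, ih]

/-- Phase lemma of the transducer. [folklore] -/
theorem initT_run_t10 (B rest : List Bool) :
    initT.run (.t10 none) (dup B ++ rest) =
      ((initT.run (.t10 none) rest).1, E (dup B) ++ (initT.run (.t10 none) rest).2) := by
  induction B with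
  | nil => simp [dup, E]
  | cons b B ih =>
    simp only [dup, List.flatMap_cons, List.cons_append, List.nil_append] at ih ⊢
    simp [FST.run_cons, inStep, ih, E]

/-- Unary numerals are blocks of `1`s. [folklore] -/
theorem unaryEncodeNat_eq_ones : ∀ n : ℕ, unaryEncodeNat n = ones n
  | 0 => rfl
  | n + 1 => by simp [unaryEncodeNat, ones, List.replicate_succ, unaryEncodeNat_eq_ones n]

/-- **The layout transducer on the thrice-headered input.** For the input word
`1^{m₂} 0 0 (S₂-doubled) 0 1 S₂` with `S₂ = 1^{m₁} 0 1^{K} 0 (S₁-doubled) 0 1 S₁`,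
`S₁ = 1^{n} 0 1^{K₁} 0 (w-doubled) 0 1 w`, `w = ⟨x, listBool ans⟩`, the output is
`none^{m₂}` followed by the some-mapped code of the initial state with bound block `1^{m₁}` and
fuel block `1^{K}`. [folklore] -/
theorem initT_eval (m₂ m₁ K n K₁ : ℕ) (x : List Bool) (ans : List (List Bool)) (w S₁ S₂ : List Bool)
    (hw : w = boolPair x ((encodingList Bool).listBool.encode ans))
    (hS₁ : S₁ = hdr n K₁ (boolPair w w)) (hS₂ : S₂ = hdr m₁ K (boolPair S₁ S₁)) :
    initT.eval (hdr m₂ 0 (boolPair S₂ S₂)) =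
      List.replicate m₂ none ++
        E (boolPair [false, false] (boolPair (boolPair (ones m₁) (ones K))
          (boolPair (boolPair x [false, true]) (boolPair [false, true, false, true]
            (boolPair (ans.foldr (fun a acc => boolPair a acc) []) (boolPair [] [])))))) := by
  have he : ∀ l, initT.eval l = (initT.run .t0 l).2 := fun l => by simp [FST.eval, initT]
  rw [he]
  have hw' : w = dup x ++ false :: true :: (dup (ones ans.length) ++ false :: true ::
      ans.foldr (fun a acc => boolPair a acc) []) := by
    rw [hw]
    change boolPair x (boolPair (unaryEncodeNat ans.length) _) = _
    rw [boolPair_eq_dup, boolPair_eq_dup, unaryEncodeNat_eq_ones]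
    rfl
  -- the iteration count and the terminators
  have h0 : hdr m₂ 0 (boolPair S₂ S₂) = ones m₂ ++ false :: false :: (dup S₂ ++ false :: true :: S₂) := by
    simp [hdr, ones, boolPair_eq_dup]
  rw [h0, initT_run_t0]
  simp only [FST.run_cons, initT_step, inStep, List.nil_append]
  rw [initT_run_t2]
  -- the second header string: bound and fuel blocks, then the doubled first header string
  have h2 : S₂ = ones m₁ ++ false :: (ones K ++ false :: (dup S₁ ++ false :: true :: S₁)) := by
    rw [hS₂]; simp [hdr, boolPair_eq_dup]
  rw [h2, initT_run_t3, initT_run_t4, initT_run_t5]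
  -- the first header string: two blocks to skip, then the doubled input word
  have h1 : S₁ = ones n ++ false :: (ones K₁ ++ false :: (dup (dup x) ++ false :: false :: true :: true ::
      (dup (dup (ones ans.length)) ++ false :: false :: true :: true ::
        (dup (ans.foldr (fun a acc => boolPair a acc) []) ++ false :: true :: w)))) := by
    have hdw : dup w = dup (dup x) ++ false :: false :: true :: true ::
        (dup (dup (ones ans.length)) ++ false :: false :: true :: true ::
          dup (ans.foldr (fun a acc => boolPair a acc) [])) := by
      rw [hw']; simp [dup, List.flatMap_append]
    rw [hS₁, hdr, boolPair_eq_dup, hdw]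
    simp [List.append_assoc]
  rw [h1, initT_run_t6, initT_run_t7, initT_run_t8]
  simp only [FST.run_cons, initT_step, inStep, ↓reduceIte, Bool.false_eq_true]
  rw [initT_run_t9]
  simp only [FST.run_cons, initT_step, inStep, ↓reduceIte, Bool.false_eq_true]
  rw [initT_run_t10]
  simp only [FST.run_cons, initT_step, inStep, Bool.false_eq_true, ↓reduceIte, initT_run_t11,
    List.append_nil]
  -- both sides are the same word
  simp [E, midConst, boolPair_eq_dup, dup, List.flatMap_append, List.append_assoc]

end OCM

namespace OracleComposition

open OCM StrCopy Polynomial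

variable {β : Type} (eb : Encoding β Bool) (M : OracleAlg β) (N : OracleAlg (List Bool))

/-! ### Assembly: the composite step function is polynomial-time -/

/-- The clamp bound realised by the machine on inputs of length `n`: the length of the first
header string `hdr n (P n) ⟨w, w⟩`. [folklore] -/
def m₁Of (P : Polynomial ℕ) (n : ℕ) : ℕ := 4 * n + P.eval n + 4

/-- The number of micro-steps realised by the machine: the length of the second header string.
[folklore] -/
def m₂Of (P : Polynomial ℕ) (n : ℕ) : ℕ := 4 * m₁Of P n + 2 * m₁Of P n * chunk (m₁Of P n) + 4

/-- The resource parameters realised by the machine. [folklore] -/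
def prmOf (P : Polynomial ℕ) : Params where
  bndOf := m₁Of P
  padOf n := 2 * m₁Of P n
  iterOf := m₂Of P

/-- The fuel polynomial `2X · (2X + 4)` (number of fuel units times `chunk`). [folklore] -/
noncomputable def padPoly : Polynomial ℕ := 2 * X * (2 * X + 4)

/-- Value of the fuel polynomial. [folklore] -/
@[simp] theorem eval_padPoly (m : ℕ) : padPoly.eval m = 2 * m * chunk m := by
  simp [padPoly, chunk]

/-- The string pipeline before the layout transducer: three unary headers. [folklore] -/
noncomputable def preInit (P : Polynomial ℕ) : List Bool → List Bool :=
  initFn ∘ copyFn ∘ evalHdrFn padPoly ∘ copyFn ∘ evalHdrFn P ∘ copyFn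

/-- `preInit` is in `FP`. [folklore] -/
theorem preInit_mem_FP (P : Polynomial ℕ) : preInit P ∈ FP :=
  comp_mem_FP initFn_mem_FP (comp_mem_FP copyFn_mem_FP (comp_mem_FP (evalHdrFn_mem_FP _)
    (comp_mem_FP copyFn_mem_FP (comp_mem_FP (evalHdrFn_mem_FP P) copyFn_mem_FP))))

/-- Length of the first header string. [folklore] -/
theorem length_hdr₁ (P : Polynomial ℕ) (w : List Bool) :
    (hdr w.length (P.eval w.length) (boolPair w w)).length = m₁Of P w.length := by
  simp [m₁Of]; omega

/-- Length of the second header string. [folklore] -/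
theorem length_hdr₂ (P : Polynomial ℕ) (w S₁ : List Bool) (h : S₁.length = m₁Of P w.length) :
    (hdr S₁.length (padPoly.eval S₁.length) (boolPair S₁ S₁)).length = m₂Of P w.length := by
  simp [m₂Of, h]; omega

/-- The value of the string pipeline. [folklore] -/
theorem preInit_apply (P : Polynomial ℕ) (w : List Bool) :
    preInit P w = hdr (m₂Of P w.length) 0
      (boolPair (hdr (m₁Of P w.length) (padPoly.eval (m₁Of P w.length))
        (boolPair (hdr w.length (P.eval w.length) (boolPair w w))
          (hdr w.length (P.eval w.length) (boolPair w w))))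
        (hdr (m₁Of P w.length) (padPoly.eval (m₁Of P w.length))
        (boolPair (hdr w.length (P.eval w.length) (boolPair w w))
          (hdr w.length (P.eval w.length) (boolPair w w))))) := by
  have h1 := length_hdr₁ P w
  have h2 := length_hdr₂ P w _ h1
  simp only [preInit, Function.comp_apply, copyFn_apply, evalHdrFn, initFn, boolUnpair_boolPair, h1]
  rw [h1] at h2
  rw [h2]

variable {eb M N}

/-- **Preparing the iteration input is polynomial-time**: from `⟨x, listBool answers⟩` to
`none^{m₂}` followed by the code of the initial state. [folklore] -/
theorem polyTime_init (P : Polynomial ℕ) :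
    PolyTimeComputable (fun p : List Bool × List (List Bool) => encA p.1 p.2)
      (fun q : State β × ℕ => List.replicate q.2 none ++ (enc eb q.1).map some)
      (fun p => (initState (prmOf P) p.1 p.2, (prmOf P).iterOf (inputLength p.1 p.2))) := by
  have hS : PolyTimeComputable (id : List Bool → List Bool) (id : List (Option Bool) → _)
      (initT.eval ∘ preInit P) :=
    PolyTimeComputable.comp_holds initT.polyTimeComputable_eval (preInit_mem_FP P)
  refine hS.of_encode (fun p : List Bool × List (List Bool) => encA p.1 p.2) (fun _ => rfl) fun p => ?_
  obtain ⟨x, ans⟩ := p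
  simp only [Function.comp_apply, id, encA, preInit_apply]
  rw [initT_eval (m₂Of P _) (m₁Of P _) _ _ (P.eval _) x ans _ _ _ rfl rfl rfl]
  simp only [inputLength, prmOf, initState, enc, phCode, encPB, encA, blocks, resCode, eval_padPoly]
  rfl

/-- **The step function of the composite machine is polynomial-time** (readout ∘ clocked
iteration ∘ layout). [Arora–Barak 2009, §3.4 with Claim 1.6] [cite: AroraBarak2009, §3.4] -/
theorem isPolyTime_compose (hM : M.IsPolyTime eb) (hN : N.IsPolyTime (encodingList Bool))
    (P : Polynomial ℕ) : (compose M N eb (prmOf P)).IsPolyTime eb :=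
  (PolyTimeComputable.comp_holds (polyTime_readout eb)
    (PolyTimeComputable.comp_holds (polyTime_iterate_G hM hN) (polyTime_init P))).of_encode id
    (fun _ => rfl) (fun _ => rfl)

/-- **Discharge of the named fact `OracleAlg.isPolyTime_compose`.** [Arora–Barak 2009, §3.4
with Claim 1.6; Ladner–Lynch–Selman 1975, §2] [cite: AroraBarak2009, §3.4] -/
theorem _root_.Literature.Computability.Complexity.OracleAlg.isPolyTime_compose_holds : OracleAlg.isPolyTime_compose := by
  intro β eb M N hM hN P
  refine ⟨prmOf P, fun n => ⟨?_, ?_, ?_⟩, isPolyTime_compose hM hN P⟩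
  · simp only [prmOf, m₁Of]; omega
  · simp only [prmOf, m₁Of]; omega
  · simp only [prmOf, m₂Of, m₁Of]; nlinarith

end OracleComposition


/-! ### Unconditional closure theorems -/

namespace OracleAlg

/-- **`f ∈ FP^O ⟹ P^f ⊆ P^O`** (polynomial-time oracle machines compose; transcript model of
`Oracle.lean`). This is the body of the named fact
`Literature.Computability.QuantumComplexity.PRel_subset_PRel_of_mem_FPRel` (Arora–Barak 2009, Example 3.6 (2) with
Remark 3.8, relativised, for function oracles). [Ladner–Lynch–Selman 1975, §2; Arora–Barak 2009,
§3.4 with Claim 1.6] [cite: LadnerLynchSelman1975, §2] -/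
theorem PRel_subset_PRel_of_mem_FPRel {O f : Oracle} (hf : f ∈ FPRel O) : PRel f ⊆ PRel O :=
  PRel_subset_PRel_of_mem_FPRel_of isPolyTime_compose_holds O f hf

/-- **`f ∈ FP^O ⟹ FP^f ⊆ FP^O`.** [Ladner–Lynch–Selman 1975, §2; Arora–Barak 2009, §17.2]
[cite: LadnerLynchSelman1975, §2] -/
theorem FPRel_subset_FPRel_of_mem_FPRel {O f : Oracle} (hf : f ∈ FPRel O) : FPRel f ⊆ FPRel O :=
  FPRel_subset_FPRel_of_mem_FPRel_of isPolyTime_compose_holds O f hf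

end OracleAlg

end Literature.Computability.Complexity
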